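import Mathlib
import Literature.Analysis.Convexity.AnisotropicPerimeterPolytopeUnionCancel
import Literature.Analysis.Convexity.AnisotropicPerimeterPatches
import Literature.Analysis.Convexity.AnisotropicPerimeterLowerSemicontinuity
import HarnessLib

/-!
# Finite disjoint unions of open polytopes of `ℝ³`, II: the divergence identity and the patch formula

Topic `Literature/Analysis/Convexity`; namespace `Literature.Analysis.Convexity`.
* `setIntegral_fieldDivergence_iUnion_cells` — `∫_{⋃ Q_i} div η = Σ_{(i,c)} ∫_{D_{ic}} ⟪η∘Φ_c, c.1⟫`
  with the patches `D_{ic} = Φ_c⁻¹(oF_i(c) ∖ ⋃_{j≠i} closure Q_j)` (Gauss–Green cell by cell, facet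
  splitting, cancellation of the contact parts);
* `anisotropicPerimeter_iUnion_cells_eq_patchSum` — hence, by the patch theorem
  (`anisotropicPerimeter_eq_facetSum_of_patches`; the patches are separated),
  `P_K(⋃ Q_i) = ofReal (Σ_{(i,c)} h_K(c.1)·|D_{ic}|)`;
* `volume_openFacet_split`, `sum_sum_erase_eq_sum_sum_lt` — measure/finset bookkeeping for III.
[cite: Maggi2012, (20.2) p. 258 and Remark 20.3; EvansGariepy2015, Thm 5.16 (Gauss–Green), polyhedral case]
-/

noncomputable section

namespace Literature.Analysis.Convexity

open _root_.MeasureTheory Set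
open scoped RealInnerProductSpace Topology ENNReal
open Literature.MathematicalPhysics.StatisticalMechanics (fieldDivergence)
open Literature.MeasureTheory.Integral

/-- **The divergence identity for a finite disjoint union of bounded open polytopes, in patch form**:
`∫_{⋃ Q_i} div η = Σ_{(i,c)} ∫_{D_{ic}} ⟪η(Φ_c y), c.1⟫ dy` with the patches
`D_{ic} = Φ_c⁻¹(oF_i(c) ∖ ⋃_{j ≠ i} closure Q_j)` (internal facets cancel).
[cite: EvansGariepy2015, Thm 5.16 (Gauss–Green), polyhedral case; Maggi2012, Remark 20.3 p. 258] -/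
theorem setIntegral_fieldDivergence_iUnion_cells {k : ℕ} (H : Fin k → Finset (EuclideanSpace ℝ (Fin 3) × ℝ))
    (Q : Fin k → Set (EuclideanSpace ℝ (Fin 3)))
    (hQ : ∀ i, Q i = ⋂ p ∈ H i, {x : EuclideanSpace ℝ (Fin 3) | ⟪p.1, x⟫ < p.2})
    (J : Fin k → Finset (EuclideanSpace ℝ (Fin 3) × ℝ))
    (hJ : ∀ i, J i = ((H i).filter (fun p => p.1 ≠ 0)).image (fun p => (‖p.1‖⁻¹ • p.1, ‖p.1‖⁻¹ * p.2)))
    (fU fV : EuclideanSpace ℝ (Fin 3) → EuclideanSpace ℝ (Fin 3))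
    (hfr : ∀ a, ‖a‖ = 1 → ‖fU a‖ = 1 ∧ ‖fV a‖ = 1 ∧ ⟪fU a, fV a⟫ = 0 ∧ ⟪a, fU a⟫ = 0 ∧ ⟪a, fV a⟫ = 0)
    (hsym : ∀ a, fU (-a) = fU a ∧ fV (-a) = fV a)
    (Φ : EuclideanSpace ℝ (Fin 3) × ℝ → ℝ × ℝ → EuclideanSpace ℝ (Fin 3))
    (hΦ : ∀ c y, Φ c y = c.2 • c.1 + y.1 • fU c.1 + y.2 • fV c.1)
    (oF : Fin k → EuclideanSpace ℝ (Fin 3) × ℝ → Set (EuclideanSpace ℝ (Fin 3)))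
    (hoF : ∀ i c, oF i c = {x | ⟪c.1, x⟫ = c.2 ∧ ∀ c' ∈ J i, c' ≠ c → ⟪c'.1, x⟫ < c'.2})
    (I : Finset (Fin k)) (hI : ∀ i, i ∈ I ↔ (Q i).Nonempty)
    (hbd : ∀ i, Bornology.IsBounded (Q i)) (hdisj : ∀ i j, i ≠ j → Disjoint (Q i) (Q j))
    {η : EuclideanSpace ℝ (Fin 3) → EuclideanSpace ℝ (Fin 3)} (hη : ContDiff ℝ 1 η)
    (hηc : HasCompactSupport η) :
    ∫ x in ⋃ i, Q i, fieldDivergence η x =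
      ∑ m ∈ I.sigma J, ∫ y in Φ m.2 ⁻¹' (oF m.1 m.2 \ ⋃ j ∈ I.erase m.1, closure (Q j)),
        ⟪η (Φ m.2 y), m.2.1⟫ := by
  classical
  have hQo : ∀ i, IsOpen (Q i) := fun i => by rw [hQ]; exact isOpen_openHPolytope (H i)
  have hdivint : Integrable (fieldDivergence η) volume :=
    (continuous_fieldDivergence hη).integrable_of_hasCompactSupport (hasCompactSupport_fieldDivergence' hηc)
  -- Step 1: cell by cell
  rw [integral_iUnion_fintype (fun i => (hQo i).measurableSet) (fun i j hij => hdisj i j hij)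
    (fun i => hdivint.integrableOn)]
  rw [← Finset.sum_subset (Finset.subset_univ I) (fun i _ hi => by
    have : Q i = ∅ := Set.not_nonempty_iff_eq_empty.1 (fun h => hi ((hI i).2 h))
    rw [this, Measure.restrict_empty, integral_zero_measure])]
  -- Step 2: Gauss–Green on each nonempty cell, then split each facet integral
  have hcell : ∀ i ∈ I, ∫ x in Q i, fieldDivergence η x =
      ∑ c ∈ J i, ((∫ y in Φ c ⁻¹' (oF i c \ ⋃ j ∈ I.erase i, closure (Q j)), ⟪η (Φ c y), c.1⟫) +
        ∑ j ∈ I.erase i, ∫ y in Φ c ⁻¹' (oF i c ∩ oF j (-c.1, -c.2)), ⟪η (Φ c y), c.1⟫) := by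
    intro i hi
    obtain ⟨hQi, h1i, hndi, hcli⟩ := cell_normalForm H Q hQ J hJ ((hI i).1 hi)
    have hne' : (⋂ c ∈ J i, {x : EuclideanSpace ℝ (Fin 3) | ⟪c.1, x⟫ < c.2}).Nonempty := by
      rw [← hQi]; exact (hI i).1 hi
    have hbd' : Bornology.IsBounded (⋂ c ∈ J i, {x : EuclideanSpace ℝ (Fin 3) | ⟪c.1, x⟫ < c.2}) := by
      rw [← hQi]; exact hbd i
    rw [hQi, setIntegral_fieldDivergence_openHPolytope_eq_facetSum (J i) h1i hndi hne' hbd'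
      (fun c => fU c.1) (fun c => fV c.1) (fun c hc => (hfr c.1 (h1i c hc)).1)
      (fun c hc => (hfr c.1 (h1i c hc)).2.1) (fun c hc => (hfr c.1 (h1i c hc)).2.2.1)
      (fun c hc => (hfr c.1 (h1i c hc)).2.2.2.1) (fun c hc => (hfr c.1 (h1i c hc)).2.2.2.2) hη]
    refine Finset.sum_congr rfl fun c hc => ?_
    have hΦc : (fun y : ℝ × ℝ => c.2 • c.1 + y.1 • fU c.1 + y.2 • fV c.1) = Φ c := (funext (hΦ c)).symm
    rw [hΦc, ← hoF i c]
    simp only [← hΦ c]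
    -- integrability of the facet integrand on the whole chart plane (compact support)
    obtain ⟨hU1, hV1, hUV, haU, haV⟩ := hfr c.1 (h1i c hc)
    have hΦcont : Continuous (Φ c) := by rw [← hΦc]; fun_prop
    have hg : Integrable (fun y : ℝ × ℝ => ⟪η (Φ c y), c.1⟫) volume := by
      refine Continuous.integrable_of_hasCompactSupport (by fun_prop) ?_
      refine HasCompactSupport.intro ((funext (hΦ c)) ▸ isCompact_chartPreimage c (fU c.1) (fV c.1)
        hU1 hV1 hUV hηc.isCompact) fun y hy => ?_
      rw [image_eq_zero_of_notMem_tsupport (fun h => hy h), inner_zero_left]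
    exact setIntegral_openFacet_split H Q hQ J hJ fU fV hfr Φ hΦ oF hoF I hI hdisj hi hc hg
  rw [Finset.sum_congr rfl hcell]
  simp only [Finset.sum_add_distrib]
  rw [sum_contact_integral_eq_zero H Q hQ J hJ fU fV hsym Φ hΦ oF hoF I hI hdisj η, add_zero,
    Finset.sum_sigma]

/-- **Facet-sum formula for a finite disjoint union of bounded open polytopes (patch form)**:
`P_K(⋃ Q_i) = ofReal (Σ_{(i,c)} h_K(c.1) · |D_{ic}|)` with the patches of
`setIntegral_fieldDivergence_iUnion_cells`, for every compact convex `K ∋ 0`.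
[cite: Maggi2012, (20.2) p. 258 and Remark 20.3; EvansGariepy2015, Thm 5.16 (Gauss–Green), polyhedral case] -/
theorem anisotropicPerimeter_iUnion_cells_eq_patchSum {k : ℕ}
    (H : Fin k → Finset (EuclideanSpace ℝ (Fin 3) × ℝ)) (Q : Fin k → Set (EuclideanSpace ℝ (Fin 3)))
    (hQ : ∀ i, Q i = ⋂ p ∈ H i, {x : EuclideanSpace ℝ (Fin 3) | ⟪p.1, x⟫ < p.2})
    (J : Fin k → Finset (EuclideanSpace ℝ (Fin 3) × ℝ))
    (hJ : ∀ i, J i = ((H i).filter (fun p => p.1 ≠ 0)).image (fun p => (‖p.1‖⁻¹ • p.1, ‖p.1‖⁻¹ * p.2)))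
    (fU fV : EuclideanSpace ℝ (Fin 3) → EuclideanSpace ℝ (Fin 3))
    (hfr : ∀ a, ‖a‖ = 1 → ‖fU a‖ = 1 ∧ ‖fV a‖ = 1 ∧ ⟪fU a, fV a⟫ = 0 ∧ ⟪a, fU a⟫ = 0 ∧ ⟪a, fV a⟫ = 0)
    (hsym : ∀ a, fU (-a) = fU a ∧ fV (-a) = fV a)
    (Φ : EuclideanSpace ℝ (Fin 3) × ℝ → ℝ × ℝ → EuclideanSpace ℝ (Fin 3))
    (hΦ : ∀ c y, Φ c y = c.2 • c.1 + y.1 • fU c.1 + y.2 • fV c.1)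
    (oF : Fin k → EuclideanSpace ℝ (Fin 3) × ℝ → Set (EuclideanSpace ℝ (Fin 3)))
    (hoF : ∀ i c, oF i c = {x | ⟪c.1, x⟫ = c.2 ∧ ∀ c' ∈ J i, c' ≠ c → ⟪c'.1, x⟫ < c'.2})
    (I : Finset (Fin k)) (hI : ∀ i, i ∈ I ↔ (Q i).Nonempty)
    (hbd : ∀ i, Bornology.IsBounded (Q i)) (hdisj : ∀ i j, i ≠ j → Disjoint (Q i) (Q j))
    {K : Set (EuclideanSpace ℝ (Fin 3))} (hKc : IsCompact K) (hK : Convex ℝ K)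
    (hK0 : (0 : EuclideanSpace ℝ (Fin 3)) ∈ K) :
    anisotropicPerimeter K (⋃ i, Q i) =
      ENNReal.ofReal (∑ m ∈ I.sigma J, sSup ((fun y => ⟪y, m.2.1⟫) '' K) *
        (volume (Φ m.2 ⁻¹' (oF m.1 m.2 \ ⋃ j ∈ I.erase m.1, closure (Q j)))).toReal) := by
  classical
  have hmeas_oF : ∀ j e, MeasurableSet (oF j e) := fun j e => by
    rw [hoF]; exact measurableSet_openFacet (J j) e
  have hWc : ∀ i, IsClosed (⋃ j ∈ I.erase i, closure (Q j)) :=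
    fun i => isClosed_biUnion_finset fun j _ => isClosed_closure
  refine anisotropicPerimeter_eq_facetSum_of_patches (I.sigma J) (fun m => Φ m.2)
    (fun m _ => by rw [funext (hΦ m.2)]; fun_prop)
    (fun m => Φ m.2 ⁻¹' (oF m.1 m.2 \ ⋃ j ∈ I.erase m.1, closure (Q j)))
    (fun m _ => ((hmeas_oF m.1 m.2).diff (hWc m.1).measurableSet).preimage
      (by rw [funext (hΦ m.2)]; fun_prop))
    (fun m hm => ?_) (fun m => m.2.1) (fun m hm m' hm' hmm' => ?_)
    (fun η hη hηc => setIntegral_fieldDivergence_iUnion_cells H Q hQ J hJ fU fV hfr hsym Φ hΦ oF hoF I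
      hI hbd hdisj hη hηc) hKc hK hK0
  · -- finiteness: inside the compact chart preimage of `closure (Q i)`
    obtain ⟨hi, hc⟩ := Finset.mem_sigma.1 hm
    obtain ⟨hQi, h1i, -, hcli⟩ := cell_normalForm H Q hQ J hJ ((hI m.1).1 hi)
    obtain ⟨hU1, hV1, hUV, -, -⟩ := hfr m.2.1 (h1i m.2 hc)
    have hcpt : IsCompact (closure (Q m.1)) :=
      Metric.isCompact_of_isClosed_isBounded isClosed_closure (hbd m.1).closure
    have hsub : Φ m.2 ⁻¹' (oF m.1 m.2 \ ⋃ j ∈ I.erase m.1, closure (Q j)) ⊆ Φ m.2 ⁻¹' closure (Q m.1) := by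
      refine Set.preimage_mono (Set.sdiff_subset.trans ?_)
      rw [hoF, hcli]; exact openFacet_subset_closedHPolytope (J m.1)
    refine (lt_of_le_of_lt (measure_mono hsub) ?_).ne
    rw [funext (hΦ m.2)]
    exact (isCompact_chartPreimage m.2 (fU m.2.1) (fV m.2.1) hU1 hV1 hUV hcpt).measure_lt_top
  · -- separation of the patches
    obtain ⟨hi, hc⟩ := Finset.mem_sigma.1 hm
    obtain ⟨hi', hc'⟩ := Finset.mem_sigma.1 hm'
    refine Disjoint.mono (Set.image_preimage_subset _ _) (closure_mono (Set.image_preimage_subset _ _)) ?_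
    by_cases hii : m.1 = m'.1
    · -- same cell, distinct constraints
      have hcc : m.2 ≠ m'.2 := fun h => hmm' (Sigma.ext hii (heq_of_eq h))
      refine Disjoint.mono Set.sdiff_subset (closure_mono Set.sdiff_subset) ?_
      rw [hoF, hoF, hii]
      exact disjoint_openFacet_closure_openFacet (J m'.1) hc' (Ne.symm hcc)
    · -- different cells: the patch of `m` avoids `closure (Q m'.1) ⊇ closure (oF m'.1 m'.2)`
      obtain ⟨-, -, -, hcli'⟩ := cell_normalForm H Q hQ J hJ ((hI m'.1).1 hi')
      have h1 : closure (oF m'.1 m'.2 \ ⋃ j ∈ I.erase m'.1, closure (Q j)) ⊆ closure (Q m'.1) := by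
        refine closure_minimal (Set.sdiff_subset.trans ?_) isClosed_closure
        rw [hoF, hcli']; exact openFacet_subset_closedHPolytope (J m'.1)
      have h2 : oF m.1 m.2 \ (⋃ j ∈ I.erase m.1, closure (Q j)) ⊆ (closure (Q m'.1))ᶜ := by
        intro x hx hx'
        exact hx.2 (Set.mem_biUnion (Finset.mem_erase.2 ⟨Ne.symm hii, hi'⟩) hx')
      exact Disjoint.mono h2 h1 disjoint_compl_left


/-- **Measure version of the facet split**: `|Φ_c⁻¹(oF_i(c))| = |D_{ic}| + Σ_{j ≠ i} |Z_{icj}|`.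
[cite: EvansGariepy2015, Thm 5.16 (Gauss–Green), polyhedral case — plumbing] -/
theorem volume_openFacet_split {k : ℕ} (H : Fin k → Finset (EuclideanSpace ℝ (Fin 3) × ℝ))
    (Q : Fin k → Set (EuclideanSpace ℝ (Fin 3)))
    (hQ : ∀ i, Q i = ⋂ p ∈ H i, {x : EuclideanSpace ℝ (Fin 3) | ⟪p.1, x⟫ < p.2})
    (J : Fin k → Finset (EuclideanSpace ℝ (Fin 3) × ℝ))
    (hJ : ∀ i, J i = ((H i).filter (fun p => p.1 ≠ 0)).image (fun p => (‖p.1‖⁻¹ • p.1, ‖p.1‖⁻¹ * p.2)))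
    (fU fV : EuclideanSpace ℝ (Fin 3) → EuclideanSpace ℝ (Fin 3))
    (hfr : ∀ a, ‖a‖ = 1 → ‖fU a‖ = 1 ∧ ‖fV a‖ = 1 ∧ ⟪fU a, fV a⟫ = 0 ∧ ⟪a, fU a⟫ = 0 ∧ ⟪a, fV a⟫ = 0)
    (Φ : EuclideanSpace ℝ (Fin 3) × ℝ → ℝ × ℝ → EuclideanSpace ℝ (Fin 3))
    (hΦ : ∀ c y, Φ c y = c.2 • c.1 + y.1 • fU c.1 + y.2 • fV c.1)
    (oF : Fin k → EuclideanSpace ℝ (Fin 3) × ℝ → Set (EuclideanSpace ℝ (Fin 3)))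
    (hoF : ∀ i c, oF i c = {x | ⟪c.1, x⟫ = c.2 ∧ ∀ c' ∈ J i, c' ≠ c → ⟪c'.1, x⟫ < c'.2})
    (I : Finset (Fin k)) (hI : ∀ i, i ∈ I ↔ (Q i).Nonempty)
    (hdisj : ∀ i j, i ≠ j → Disjoint (Q i) (Q j))
    {i : Fin k} (hi : i ∈ I) {c : EuclideanSpace ℝ (Fin 3) × ℝ} (hc : c ∈ J i) :
    volume (Φ c ⁻¹' oF i c) =
      volume (Φ c ⁻¹' (oF i c \ ⋃ j ∈ I.erase i, closure (Q j))) +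
        ∑ j ∈ I.erase i, volume (Φ c ⁻¹' (oF i c ∩ oF j (-c.1, -c.2))) := by
  classical
  obtain ⟨hQi, h1i, hndi, hcli⟩ := cell_normalForm H Q hQ J hJ ((hI i).1 hi)
  obtain ⟨hU1, hV1, hUV, haU, haV⟩ := hfr c.1 (h1i c hc)
  have hΦc : (Φ c) = fun y : ℝ × ℝ => c.2 • c.1 + y.1 • fU c.1 + y.2 • fV c.1 := funext (hΦ c)
  have hΦcont : Continuous (Φ c) := by rw [hΦc]; fun_prop
  have hmeas_oF : ∀ j e, MeasurableSet (oF j e) := fun j e => by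
    rw [hoF]; exact measurableSet_openFacet (J j) e
  set W : Set (EuclideanSpace ℝ (Fin 3)) := ⋃ j ∈ I.erase i, closure (Q j) with hW
  have hWc : IsClosed W := isClosed_biUnion_finset fun j _ => isClosed_closure
  have hsplit : Φ c ⁻¹' oF i c = Φ c ⁻¹' (oF i c \ W) ∪ Φ c ⁻¹' (oF i c ∩ W) := by
    rw [← Set.preimage_union, Set.sdiff_union_inter]
  have hdisjDG : Disjoint (Φ c ⁻¹' (oF i c \ W)) (Φ c ⁻¹' (oF i c ∩ W)) :=
    Disjoint.preimage _ (Set.disjoint_left.2 fun x hx hx' => hx.2 hx'.2)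
  rw [hsplit, measure_union hdisjDG (((hmeas_oF i c).inter hWc.measurableSet).preimage hΦcont.measurable)]
  congr 1
  have hZsub : ∀ j ∈ I.erase i, Φ c ⁻¹' (oF i c ∩ oF j (-c.1, -c.2)) ⊆ Φ c ⁻¹' (oF i c ∩ W) := by
    intro j hj y hy
    refine ⟨hy.1, Set.mem_biUnion hj ?_⟩
    have hjI : j ∈ I := (Finset.mem_erase.1 hj).2
    obtain ⟨-, -, -, hclj⟩ := cell_normalForm H Q hQ J hJ ((hI j).1 hjI)
    rw [hclj]
    have : Φ c y ∈ oF j (-c.1, -c.2) := hy.2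
    rw [hoF] at this
    exact openFacet_subset_closedHPolytope (J j) this
  have hae : (Φ c ⁻¹' (oF i c ∩ W) : Set (ℝ × ℝ)) =ᵐ[volume]
      (⋃ j ∈ I.erase i, Φ c ⁻¹' (oF i c ∩ oF j (-c.1, -c.2)) : Set (ℝ × ℝ)) := by
    refine (ae_eq_set).2 ⟨?_, ?_⟩
    · have hcov : Φ c ⁻¹' (oF i c ∩ W) \ (⋃ j ∈ I.erase i, Φ c ⁻¹' (oF i c ∩ oF j (-c.1, -c.2))) ⊆
          ⋃ j ∈ I.erase i, (Φ c ⁻¹' (oF i c ∩ closure (Q j)) \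
            Φ c ⁻¹' (oF i c ∩ oF j (-c.1, -c.2))) := by
        intro y hy
        obtain ⟨⟨hyF, hyW⟩, hyn⟩ := hy
        rw [hW, Set.mem_iUnion₂] at hyW
        obtain ⟨j, hj, hyj⟩ := hyW
        refine Set.mem_biUnion hj ⟨⟨hyF, hyj⟩, fun h => hyn (Set.mem_biUnion hj h)⟩
      refine measure_mono_null hcov ((measure_biUnion_null_iff (I.erase i).countable_toSet).2
        fun j hj => ?_)
      have hjI : j ∈ I := (Finset.mem_erase.1 hj).2
      have hji : j ≠ i := (Finset.mem_erase.1 hj).1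
      obtain ⟨hQj, h1j, -, -⟩ := cell_normalForm H Q hQ J hJ ((hI j).1 hjI)
      have := volume_contact_diff_eq_zero (J i) (J j) h1i h1j
        (by rw [← hQi]; exact (hI i).1 hi) (by rw [← hQj]; exact (hI j).1 hjI)
        (by rw [← hQi, ← hQj]; exact hdisj i j (Ne.symm hji)) hc (fU c.1) (fV c.1) hU1 hV1 hUV haU haV
      rw [hΦc, hoF, hoF, hQj]
      exact this
    · rw [Set.sdiff_eq_empty.2 (Set.iUnion₂_subset hZsub), measure_empty]
  rw [measure_congr hae]
  refine measure_biUnion_finset ?_ (fun j _ => ((hmeas_oF i c).inter (hmeas_oF j _)).preimage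
    hΦcont.measurable)
  intro j hj j' hj' hjj'
  have hjI : j ∈ I := (Finset.mem_erase.1 (Finset.mem_coe.1 hj)).2
  have hj'I : j' ∈ I := (Finset.mem_erase.1 (Finset.mem_coe.1 hj')).2
  obtain ⟨hQj, -, -, -⟩ := cell_normalForm H Q hQ J hJ ((hI j).1 hjI)
  obtain ⟨hQj', -, -, -⟩ := cell_normalForm H Q hQ J hJ ((hI j').1 hj'I)
  have hc0 : ((-c.1, -c.2) : EuclideanSpace ℝ (Fin 3) × ℝ).1 ≠ 0 := by
    show -c.1 ≠ 0
    rw [neg_ne_zero]; intro h; have := h1i c hc; rw [h, norm_zero] at this; exact zero_ne_one this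
  have hd := disjoint_openFacet_of_disjoint (J j) (J j') (-c.1, -c.2) hc0
    (by rw [← hQj, ← hQj']; exact hdisj j j' hjj')
  refine Disjoint.preimage _ ?_
  rw [hoF j, hoF j']
  exact Disjoint.mono Set.inter_subset_right Set.inter_subset_right hd

/-- A double sum over ordered pairs of distinct indices, symmetrised over `i < j`.
[cite: EvansGariepy2015, Thm 5.16 (Gauss–Green) — plumbing] -/
theorem sum_sum_erase_eq_sum_sum_lt {k : ℕ} (I : Finset (Fin k)) (f : Fin k → Fin k → ℝ) :
    ∑ i ∈ I, ∑ j ∈ I.erase i, f i j = ∑ i ∈ I, ∑ j ∈ I, (if i < j then f i j + f j i else 0) := by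
  classical
  have h1 : ∀ i ∈ I, ∑ j ∈ I.erase i, f i j =
      ∑ j ∈ I, ((if i < j then f i j else 0) + (if j < i then f i j else 0)) := by
    intro i _
    rw [← Finset.filter_ne', Finset.sum_filter]
    refine Finset.sum_congr rfl fun j _ => ?_
    rcases lt_trichotomy i j with h | h | h
    · simp [h, h.ne', lt_asymm h]
    · simp [h]
    · simp [h, h.ne, lt_asymm h]
  rw [Finset.sum_congr rfl h1]
  simp only [Finset.sum_add_distrib]
  rw [Finset.sum_comm (f := fun i j => if j < i then f i j else 0)]
  rw [← Finset.sum_add_distrib]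
  refine Finset.sum_congr rfl fun i _ => ?_
  rw [← Finset.sum_add_distrib]
  refine Finset.sum_congr rfl fun j _ => ?_
  split_ifs <;> ring



end Literature.Analysis.Convexity

end
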